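/-
Copyright: lit-balaban cell, Phase-2 proof seat p02 (gen 8).  Statement-level skeleton of a published paper; no proof claims beyond what
the kernel checks below.
-/
import Literature.MathematicalPhysics.QuantumFieldTheory.BalabanImbrieJaffe1984to88.BIJ88Ineq555W3CorrMechanism
import Literature.MathematicalPhysics.QuantumFieldTheory.BalabanImbrieJaffe1984to88.BIJ88Ineq555W3Torus

/-!
# `BalabanImbrieJaffe1984to88.BIJ88Ineq555W3CorrTorus` — T. Bałaban, J. Imbrie, A. Jaffe, *Effective action and cluster properties of
the abelian Higgs model*, Commun. Math. Phys. **114** (1988) 257–315 [BalabanImbrieJaffe1988]: **(5.5.5) p. 284 FOR THE SECOND KERNEL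
`w″₃` ON THE TORI OF THE SERIES, FOR THE KERNELS OF RECORD** — the correction `w″₃ − w′₃ = Q^e_k∂^η(H_kΛ₂^{(k)*}□ − H_{k,loc}Λ₂^{(k)*})` of
(5.5.4) with `H_k` = p11's Landau minimizer `HkE` (kernel `H_k(b″, b) = (H_ke_b)(b″)`, the (I.7.2.1) kernel of p09's torus carrier),
`H_{k,loc} = ζ_kH_k` (2.4) with p13's constructed (2.1) cutoff `ζ_k = cutoff (r/16) (r/8) dist` (unscaled fine-site distance, p08 g7 §3′),
`∂^η` = the `η`-lattice curl `curl (L^k)`, `Q^e_k` = the `k`-fold edge average `(torusEdgeCellsTo P 0 k k _ hd).Q` of (I.2.21), `Λ₂` a contraction,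
`□ = □(p)` row-wise with the cube clause: **`|(w″₃ − w′₃)(p,b)| ≤ e^{−cr}` with ONE `c > 0` and ONE threshold `r₁` FOR ALL `k ≤ m + K`** (no `η⁻¹`
loss), GIVEN ONLY [6I] Proposition 1.2 by its tree name; THE RANGE CLAUSE for the correction; and, with p306045's `w′₃`, r16's typed leaf
`BIJ88Sect5StatementsPart2.Ineq555` INHABITED on the tori for the kernels of record.  The one-plaquette mechanism (Leibniz + gradient member
of (I.7.2.2) + Lipschitz cutoff + cube clause) is the companion file `BIJ88Ineq555W3CorrMechanism` (same seat).

statement-level skeleton of published theorems with citation tags; proofs where landed; nothing here is a claim about the Yang–Mills mass gap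

PDF held: `paper:balaban1988-cmp114-bij-abelian-higgs-effective-action` (journal page = PDF page + 256).  Page read this session AS AN
IMAGE: p. 284 [PDF 28] (`HOME/lit-balaban-r16/renders/cmp114/original-p028-x2.png`).

CITATION HEADER (lean-in-tree rule).  Part of the lit-balaban TYPED SKELETON (HOME `run/shared/lean/pub/lit-balaban/`), Phase-2 proof seat
p02 (gen 8), unit `lit-balaban-p02-g8`; WHAT IS REPRODUCED = SKELETON row **C2.Eq5.5.5** (owner r16, referee ref-5; typed leaf `Ineq555`,
r16 p240155; kernels `wPrime3`/`wDoublePrime3`, r16 p243601; p36's matrix instance `BIJ88Ineq555Proof`), kind «model instance for the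
kernels of record», third file after p306045 `BIJ88Ineq555W3Torus` (`w′₃` + range clause); TAKING line HOME/STATUS.md 2026-08-21T21:40:42Z.
Decls of record used BY NAME (nothing restated): p08 g7's `BIJ88Ineq217Ineq722Torus.abs_curl_HkE_single_le_gradH` / `exists_bound_of_ineq722` /
`torusKernelData_gradH_nonneg` and `BIJ88HkLocTorus.ofLp_HkE_single_bond`, p09's `ineq722_deltaA_of_prop12Printed`/`levStd`/`distEU`, p31's
`BIJ85Eq224Base0.torusEdgeCellsTo`/`card_edgeBTo` and `BIJ85CellAverages.Cells.Q`, p13's `cutoff`/`isCutoff_cutoff`/`cutoff_mem_Icc`, r18's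
`loc`/`IsCutoff`/`trunc`, p30's `sigmaTorus`/`toU`, p02 g8's `BIJ88Ineq555W3Torus.ineq555_w3prime_torus`/`ineq555_of_members` and
`BIJ88Ineq555W3CorrMechanism.abs_curl_bracket_le`/`zeta_eq_zero_of_far`/`lip_cutoff_torus`.

THE PRINTED TEXT (p. 284 [PDF 28], read as an image, verbatim): *"and in the term with Λ₂^{(k)*} instead of Λ₂^{(k)*c} we put
σ_{k,loc}∂Λ₂^{(k)*}A^{(k)} = σ_{k,loc}∂Λ₂^{(k)*}□A^{(k)} = σ_k∂Λ₂^{(k)*}□A^{(k)} + w′₃A^{(k)} = Q^e_k∂^ηH_kΛ₂^{(k)*}□A^{(k)} + w′₃A^{(k)} =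
Q^e_k∂^ηH_{k,loc}Λ₂^{(k)*}A^{(k)} + w″₃A^{(k)}. (5.5.4) The ½r(e_k)-cube □ is centered near the plaquette that we are evaluating
σ_{k,loc}∂Λ₂^{(k)*}A^{(k)} at. The kernels w′₃, w″₃ have range less than ½r(e_k), and we have |w′₃(p,b)|, |w″₃(p,b)| ≦ e^{−cr(e_k)}. (5.5.5)
In (5.5.4) we have applied our usual method for obtaining formulas for localized kernels analogous to those valid for unlocalized ones [in
this case, (5.5.1)]. The precise form of the error terms will be unimportant; only bounds like (5.5.5) will matter."*

THE READING (p36's `wDoublePrime3_apply`, now on the torus): the `(p, b)` entry of `w″₃ − w′₃` (`p` a unit plaquette, `b` a unit bond of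
`T₁^{(k)}`) is `(Q^e_k ∂^η G_b)(p)·χ₂(b)` with the bracket column `G_b(b″) = H_k(b″,b)χ_{□(p)}(b) − H_{k,loc}(b″,b)`, `Λ₂ = χ₂` any contraction,
`□ = □(p)` row-wise (`|χ□| ≤ 1`) with *"centered near the plaquette"* typed as `□(p) ⊇ {b : |p₋ − b₋|_∞ ≤ r/8 + 2}` (a ½r-cube of radius `r/4`
about `p` does, `r ≥ 24`).

WHAT IS PROVED (0 `sorry`, standard axioms; theorems only — proof lane):
* §1 `abs_cellsQ_le_of_card` (an (I.2.21) average is bounded by the sup over its block), **`abs_w3corr_le_explicit`** —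
  `|(Q^e_k∂^ηG_b)(p)χ₂(b)| ≤ (2 + 3Ke^δ)Me^{−δr/16}` from the companion file's one-plaquette bound over the face `B^e_k(p)`
  (`|B^e_k(p)| = (L^k)^{d−2}`), explicit hypotheses; `w3corr_eq_zero_of_box` — THE RANGE CLAUSE: the correction vanishes at every `b` off `□(p)`.
* §2 ON THE TORI FOR THE KERNELS OF RECORD, GIVEN ONLY `B5.Prop12Printed` (`levStd` family): **`ineq555_w3corr_torus`** — `∃ c > 0, r₁` such that
  for all `k ≤ m + K`, all `w > 0`, `c′ ≠ 0` (parameters of `HkE`, immaterial to its kernel), all `r ≥ r₁`, `|χ₂| ≤ 1`, `|χ□| ≤ 1` with the cube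
  clause, all `p, b`: `|(w″₃ − w′₃)(p,b)| ≤ e^{−cr}` (`c = δ/32`, `r₁ = max(16, 32(2 + 3Ce^δ)M/δ)`, `(δ, M)` the (I.7.2.2) pair of
  `exists_bound_of_ineq722 ∘ ineq722_deltaA_of_prop12Printed`, `C` the cutoff's Lipschitz constant); and **`ineq555_w3_torus`** — r16's
  `Ineq555 (TPlaq P k) (PBond P k) w′₃ w″₃ c r` for `w′₃` of p306045 (σ_k of record, (2.14) truncation at radius `r`, unit curl `∂ = curl c_∂`)
  and `w″₃ = w′₃ + Q^e_k∂^η(H_kΛ₂□ − H_{k,loc}Λ₂)` (5.5.4): one `c`, one threshold, all `k ≤ m + K`.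
HONEST SCOPE.  (i) [6I] Proposition 1.2 enters BY NAME (`B5.Prop12Printed` for the `levStd` torus settings), exactly as in rows
C1.Eq7.2.1-7.2.2 / C2.Eq2.5–2.7 / p306045; nothing else is assumed.  (ii) `□(p)` typed by the containment clause, `Λ₂` by a contraction; the
identity `σ_k∂ = Q^e_k∂^ηH_k` (5.5.1) behind the third equality of (5.5.4) is row C2.Eq5.5.1-5.5.12's and is not used — the two kernels are
taken as printed in the last two members of (5.5.4).  (iii) The same radius `r` serves the (2.14) truncation of `σ_k` and the (2.1) thresholds
(print: both are fixed multiples of `r(e_k)`).  (iv) Constants explicit, not print's; `U = 1` real abelian fields; torus; standing range;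
`2 ≤ d`.  (v) No `def`, no new named fact: theorems only; NOT summit progress.  Unit `lit-balaban-p02-g8` (literature-prover-lit-balaban-p02-g8-0),
2026-08-21.
-/

open scoped BigOperators RealInnerProductSpace

namespace Literature.MathematicalPhysics.QuantumFieldTheory.BalabanImbrieJaffe1984to88.BIJ88Ineq555W3CorrTorus

open Balaban1983to89 hiding Site Plaq
open Balaban1983to89.LatticeFieldCalculus
open Balaban1983to89.B3TorusRadialSums (supDist_eq_zero_iff)
open BIJ88Ineq217NearPart (pdist)
open BIJ85Prop521Torus BIJ85Sigma421Torus BIJ85Prop522Torus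
open BIJ85Sect7Statements BIJ85Ineq722Torus
open BIJ85Ineq722ProofPart2 (settingOf)
open BIJ85Ineq722DeltaA (deltaAData ineq722_deltaA_of_prop12Printed)
open BIJ88Sect2Statements (trunc loc IsCutoff)
open BIJ88Sect5StatementsPart2 (Ineq555)
open BIJ88Cutoffs21 (cutoff isCutoff_cutoff cutoff_mem_Icc)
open BIJ85CellAverages (Cells)
open BIJ85Eq224Base0 (torusEdgeCellsTo card_edgeBTo)
open BIJ88Ineq217Ineq722Torus (abs_curl_HkE_single_le_gradH exists_bound_of_ineq722 torusKernelData_gradH_nonneg)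
open BIJ88HkLocTorus (ofLp_HkE_single_bond)
open BIJ88Ineq555W3Torus (ineq555_w3prime_torus ineq555_of_members)
open BIJ88Ineq555W3CorrMechanism

open Balaban1983to89 renaming Site → TSite, Plaq → TPlaq

noncomputable section

variable {P : Params}

/-! ## §1  The edge average, the correction entry, the range clause -/

/-- `|x − (x + e_μ)|_∞ ≤ 1`. [folklore] -/
private theorem supDist_shift_le' {j : ℕ} (x : TSite P j) (μ : Fin P.d) : supDist x (x.shift μ) ≤ 1 := by
  have h := supDist_runSite_le x μ 1
  have h2 : runSite x μ 1 = x.shift μ := by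
    show Function.update x μ (x μ + ((1 : ℕ) : ZMod _)) = Function.update x μ (x μ + 1)
    rw [Nat.cast_one]
  rwa [h2] at h

/-- **an (I.2.21) average is bounded by the sup over its block**: `|(Qf)(c)| ≤ C` if `|f| ≤ C` on `B(c)` and `|B(c)| = L^{d−m}`.
[cite: BalabanImbrieJaffe1985, (2.21) p.305] -/
theorem abs_cellsQ_le_of_card (G : Cells) {C : ℝ} (c : G.C) (F : G.F → ℝ)
    (hcard : (G.B c).card = G.L ^ (G.d - G.m)) (hF : ∀ q ∈ G.B c, |F q| ≤ C) : |G.Q F c| ≤ C := by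
  unfold Cells.Q
  have hL0 : (0 : ℝ) < (G.L : ℝ) := by exact_mod_cast G.one_le_L
  have hL : (0 : ℝ) < (G.L : ℝ) ^ (G.d - G.m) := pow_pos hL0 _
  rw [abs_mul, abs_inv, abs_of_pos hL]
  calc ((G.L : ℝ) ^ (G.d - G.m))⁻¹ * |∑ q ∈ G.B c, F q| ≤ ((G.L : ℝ) ^ (G.d - G.m))⁻¹ * ((G.B c).card • C) :=
        mul_le_mul_of_nonneg_left ((Finset.abs_sum_le_sum_abs _ _).trans (Finset.sum_le_card_nsmul _ _ _ hF))
          (inv_nonneg.2 hL.le)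
    _ = C := by
        rw [hcard, nsmul_eq_mul]
        push_cast
        rw [inv_mul_cancel_left₀ hL.ne']

/-- **`|(Q^e_k∂^ηG_b)(p)·χ₂(b)| ≤ (2 + 3Ke^δ)·M·e^{−δr/16}`**: the correction entry `(w″₃ − w′₃)(p, b)`, `Q^e_k` = the k-fold edge average of
(I.2.21) (an average over `|B^e_k(p)| = (L^k)^{d−2}` fine plaquettes), `|χ₂| ≤ 1`. [cite: BalabanImbrieJaffe1988, (5.5.5) p.284] -/
theorem abs_w3corr_le_explicit (hd : 2 ≤ P.d) {k : ℕ} (hk : k ≤ P.m + P.K) {H : PBond P k → VecField P 0 ℝ} {δ M : ℝ}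
    (hδ : 0 ≤ δ) (hM : 0 ≤ M) (hH : ∀ b b'', |H b b''| ≤ M * Real.exp (-(δ * distEU P k b''.src b.src)))
    (hcurl : ∀ b q, |curl ((P.L : ℝ) ^ k) (H b) q| ≤ 2 * M * Real.exp (-(δ * distEU P k q.src b.src)))
    {r K : ℝ} (hr : 0 < r) (hK : 0 ≤ K) {ζ : PBond P 0 → PBond P k → ℝ}
    (hcut : IsCutoff (fun (b'' : PBond P 0) (b' : PBond P k) => distEU P k b''.src b'.src) ζ (r / 16) (r / 8))
    (h01 : ∀ b'' b', 0 ≤ ζ b'' b' ∧ ζ b'' b' ≤ 1)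
    (hLipζ : ∀ (x x' : TSite P 0) (lam lam' : Fin P.d) (b' : PBond P k), supDist x x' ≤ 1 →
      (P.L : ℝ) ^ k * |ζ ⟨x, lam⟩ b' - ζ ⟨x', lam'⟩ b'| ≤ K)
    {χ₂ : PBond P k → ℝ} (hχ₂ : ∀ b, |χ₂ b| ≤ 1) {χb : TPlaq P k → PBond P k → ℝ} (hχb : ∀ p b, |χb p b| ≤ 1)
    (hbox : ∀ p b, (supDist p.src b.src : ℝ) ≤ r / 8 + 2 → χb p b = 1) (p : TPlaq P k) (b : PBond P k) :
    |(torusEdgeCellsTo P 0 k k (Nat.zero_add k) hd).Q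
        (curl ((P.L : ℝ) ^ k) (fun b'' => H b b'' * χb p b - loc ζ (fun b'' b' => H b' b'') b'' b)) p * χ₂ b| ≤
      (2 + 3 * K * Real.exp δ) * M * Real.exp (-(δ * (r / 16))) := by
  have hA : 0 ≤ (2 + 3 * K * Real.exp δ) * M * Real.exp (-(δ * (r / 16))) := by positivity
  rw [abs_mul]
  calc _ ≤ (2 + 3 * K * Real.exp δ) * M * Real.exp (-(δ * (r / 16))) * 1 :=
        mul_le_mul (abs_cellsQ_le_of_card _ p _ (card_edgeBTo (Nat.zero_add k) hk hd p) fun q hq =>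
          abs_curl_bracket_le hd hk hδ hM hH hcurl hr hK hcut h01 hLipζ hχb hbox hq b) (hχ₂ b) (abs_nonneg _) hA
    _ = _ := mul_one _

/-- **THE RANGE CLAUSE for the correction** — *"The kernels w′₃, w″₃ have range less than ½r(e_k)"*: at a bond `b` off the cube `□(p)`
(`χ□(p)(b) = 0`) every `ζ_k(b_i, b)` on the face vanishes, so the bracket and `(w″₃ − w′₃)(p, b)` are `0`. [cite: BalabanImbrieJaffe1988, (5.5.5) p.284] -/
theorem w3corr_eq_zero_of_box (hd : 2 ≤ P.d) {k : ℕ} (hk : k ≤ P.m + P.K) (H : PBond P k → VecField P 0 ℝ) {r : ℝ}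
    {ζ : PBond P 0 → PBond P k → ℝ}
    (hcut : IsCutoff (fun (b'' : PBond P 0) (b' : PBond P k) => distEU P k b''.src b'.src) ζ (r / 16) (r / 8))
    {χb : TPlaq P k → PBond P k → ℝ} (hbox : ∀ p b, (supDist p.src b.src : ℝ) ≤ r / 8 + 2 → χb p b = 1)
    {p : TPlaq P k} {b : PBond P k} (hb : χb p b = 0) (χ₂ : PBond P k → ℝ) :
    (torusEdgeCellsTo P 0 k k (Nat.zero_add k) hd).Q
        (curl ((P.L : ℝ) ^ k) (fun b'' => H b b'' * χb p b - loc ζ (fun b'' b' => H b' b'') b'' b)) p * χ₂ b = 0 := by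
  have hfar : r / 8 + 2 < (supDist p.src b.src : ℝ) := by
    by_contra hcon
    have h := hbox p b (not_lt.1 hcon)
    rw [hb] at h
    exact zero_ne_one h
  have hz : ∀ q ∈ (torusEdgeCellsTo P 0 k k (Nat.zero_add k) hd).B p,
      curl ((P.L : ℝ) ^ k) (fun b'' => H b b'' * χb p b - loc ζ (fun b'' b' => H b' b'') b'' b) q = 0 := by
    intro q hq
    have hs0 : supDist q.src q.src ≤ 1 := by rw [(supDist_eq_zero_iff _ _).2 rfl]; exact zero_le_one
    have hs1 : supDist q.src (q.src.shift q.μ) ≤ 1 := supDist_shift_le' _ _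
    have hs2 : supDist q.src (q.src.shift q.ν) ≤ 1 := supDist_shift_le' _ _
    simp only [curl, loc, hb, mul_zero, smul_eq_mul, zeta_eq_zero_of_far hd hk hcut hq hfar hs0,
      zeta_eq_zero_of_far hd hk hcut hq hfar hs1, zeta_eq_zero_of_far hd hk hcut hq hfar hs2, zero_mul, add_zero,
      sub_zero, mul_zero]
  unfold Cells.Q
  rw [Finset.sum_eq_zero hz, mul_zero, zero_mul]

/-! ## §2  On the tori for the kernels of record, given only [6I] Proposition 1.2 -/

/-- `Ae^{−δr/16} ≤ e^{−(δ/32)r}` once `r ≥ 32A/δ` (`e^x ≥ 1 + x`). [folklore] -/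
private theorem small_of_le {A δ r : ℝ} (hδ : 0 < δ) (hr : 32 * A / δ ≤ r) :
    A * Real.exp (-(δ * (r / 16))) ≤ Real.exp (-(δ / 32 * r)) := by
  have h1 : A ≤ δ * r / 32 := by rw [div_le_iff₀ hδ] at hr; linarith
  have h2 : δ * r / 32 ≤ Real.exp (δ * r / 32) := by linarith [Real.add_one_le_exp (δ * r / 32)]
  calc A * Real.exp (-(δ * (r / 16))) ≤ Real.exp (δ * r / 32) * Real.exp (-(δ * (r / 16))) :=
        mul_le_mul_of_nonneg_right (h1.trans h2) (Real.exp_pos _).le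
    _ = Real.exp (-(δ / 32 * r)) := by rw [← Real.exp_add]; ring_nf

/-- **(5.5.5) FOR `w″₃ − w′₃` ON THE TORI FOR THE KERNELS OF RECORD, GIVEN ONLY [6I] PROPOSITION 1.2 BY ITS TREE NAME**: `∃ c > 0, r₁` such
that for EVERY `k ≤ m + K`, every `c′ ≠ 0`, `w > 0` (parameters of p11's `HkE`), every `r ≥ r₁`, `|χ₂| ≤ 1`, `|χ□| ≤ 1` with
`□(p) ⊇ {b : |p₋ − b₋|_∞ ≤ r/8 + 2}`, and all `p, b`:
`|(Q^e_k∂^η(H_kΛ₂□(p) − H_{k,loc}Λ₂))(p, b)| ≤ e^{−cr}` with `H_k(b″,b) = (H_ke_b)(b″)`, `H_{k,loc} = ζ_kH_k`, `ζ_k = cutoff (r/16) (r/8) dist`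
— the (I.7.2.2) pair `(δ, M)` from `exists_bound_of_ineq722` ∘ `ineq722_deltaA_of_prop12Printed`, `c = δ/32`. [cite: BalabanImbrieJaffe1988, (5.5.5) p.284] -/
theorem ineq555_w3corr_torus (hd : 2 ≤ P.d) {a : ℝ} (ha : 0 < a)
    (h12 : B5.Prop12Printed (fun i => settingOf (torusRep P (levStd P i) (deltaAData (levStd_le i) a)) i)) :
    ∃ c r₁ : ℝ, 0 < c ∧ ∀ (k : ℕ) (hk : k ≤ P.m + P.K) (c' : ℝ), c' ≠ 0 → ∀ (w : ℝ), 0 < w → ∀ (r : ℝ), r₁ ≤ r →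
      ∀ (χ₂ : PBond P k → ℝ), (∀ b, |χ₂ b| ≤ 1) → ∀ (χb : TPlaq P k → PBond P k → ℝ), (∀ p b, |χb p b| ≤ 1) →
      (∀ p b, (supDist p.src b.src : ℝ) ≤ r / 8 + 2 → χb p b = 1) →
        ∀ (p : TPlaq P k) (b : PBond P k),
          |(torusEdgeCellsTo P 0 k k (Nat.zero_add k) hd).Q
              (curl ((P.L : ℝ) ^ k) (fun b'' =>
                WithLp.ofLp (HkE P w c' k (toEj P k (Pi.single b 1))) b'' * χb p b -
                  loc (cutoff (r / 16) (r / 8) (fun (b'' : PBond P 0) (b' : PBond P k) => distEU P k b''.src b'.src))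
                    (fun b'' b' => WithLp.ofLp (HkE P w c' k (toEj P k (Pi.single b' 1))) b'') b'' b)) p * χ₂ b| ≤
            Real.exp (-(c * r)) := by
  have h722 := ineq722_deltaA_of_prop12Printed (levStd P) levStd_le ha (fun _ => PUnit) (fun _ _ _ => 0)
    (fun _ _ _ _ _ => 0) (fun _ _ _ => 0) h12
  have hcov : ∀ j ≤ P.m + P.K, ∃ i, levStd P i = j := fun j hj => ⟨j, min_eq_left hj⟩
  obtain ⟨δ, M, hδ, hM, hB⟩ := exists_bound_of_ineq722 levStd_le h722
  obtain ⟨C, hC, hLip₀⟩ := exists_lipschitz_cutoffProfile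
  have hA : 0 ≤ (2 + 3 * C * Real.exp δ) * M := by positivity
  refine ⟨δ / 32, max 16 (32 * ((2 + 3 * C * Real.exp δ) * M) / δ), by positivity, ?_⟩
  intro k hk c' hc' w hw r hr χ₂ hχ₂ χb hχb hbox p b
  obtain ⟨i, hi⟩ := hcov k hk
  subst hi
  have hr16 : 16 ≤ r := (le_max_left _ _).trans hr
  have hrA : 32 * ((2 + 3 * C * Real.exp δ) * M) / δ ≤ r := (le_max_right _ _).trans hr
  have hr0 : 0 < r := by linarith
  -- (I.7.2.2) at this scale: the `|H|` member and the gradient member (curl of the column)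
  have hH : ∀ (b' : PBond P (levStd P i)) (b'' : PBond P 0),
      |WithLp.ofLp (HkE P w c' (levStd P i) (toEj P (levStd P i) (Pi.single b' 1))) b''| ≤
        M * Real.exp (-(δ * distEU P (levStd P i) b''.src b'.src)) := by
    intro b' b''
    rw [ofLp_HkE_single_bond (levStd_le i) hc' hw ha b'' b']
    exact (le_add_of_nonneg_right torusKernelData_gradH_nonneg).trans (hB i b''.dir b'.dir b''.src b'.src)
  have hcurl : ∀ (b' : PBond P (levStd P i)) (q : TPlaq P 0),
      |curl ((P.L : ℝ) ^ levStd P i) (WithLp.ofLp (HkE P w c' (levStd P i) (toEj P (levStd P i) (Pi.single b' 1)))) q| ≤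
        2 * M * Real.exp (-(δ * distEU P (levStd P i) q.src b'.src)) := by
    intro b' q
    have h1 := abs_curl_HkE_single_le_gradH (levStd_le i) hc' hw ha PUnit (fun _ _ => 0) (fun _ _ _ _ => 0) (fun _ _ => 0) b' q
    have hg := fun lam : Fin P.d => le_trans (le_add_of_nonneg_left (abs_nonneg _)) (hB i lam b'.dir q.src b'.src)
    calc _ ≤ _ := h1
      _ ≤ M * Real.exp (-(δ * distEU P (levStd P i) q.src b'.src)) + M * Real.exp (-(δ * distEU P (levStd P i) q.src b'.src)) :=
          add_le_add (hg q.ν) (hg q.μ)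
      _ = 2 * M * Real.exp (-(δ * distEU P (levStd P i) q.src b'.src)) := by ring
  have key := abs_w3corr_le_explicit hd hk
    (H := fun b' => WithLp.ofLp (HkE P w c' (levStd P i) (toEj P (levStd P i) (Pi.single b' 1)))) hδ.le hM hH hcurl hr0 hC.le
    (isCutoff_cutoff (show r / 16 < r / 8 by linarith) _) (cutoff_mem_Icc _ _ _)
    (fun x x' lam lam' b' hxx' => lip_cutoff_torus hC.le hr16 (hLip₀ (r / 16) (r / 8) (by linarith)) x x' lam lam' b' hxx')
    hχ₂ hχb hbox p b
  exact key.trans (small_of_le hδ hrA)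

/-- **(5.5.5) ON THE TORI, BOTH KERNELS, r16's TYPED LEAF INHABITED**: with `w′₃ = (σ_{k,loc} − σ_k)∂Λ₂^{(k)*}□` of p306045 (σ_k = p30's
`sigmaTorus`, (2.14) truncation at radius `r`, unit curl `∂ = curl c_∂`) and `w″₃ = w′₃ + Q^e_k∂^η(H_kΛ₂^{(k)*}□ − H_{k,loc}Λ₂^{(k)*})` (5.5.4):
`∃ c > 0, r₁, ∀ k ≤ m + K, ∀ r ≥ r₁, … Ineq555 (TPlaq P k) (PBond P k) w′₃ w″₃ c r` — *"|w′₃(p,b)|, |w″₃(p,b)| ≦ e^{−cr(e_k)}"* for the kernels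
of record, given only [6I] Proposition 1.2 by its tree name. [cite: BalabanImbrieJaffe1988, (5.5.5) p.284] -/
theorem ineq555_w3_torus (hd : 2 ≤ P.d) {a : ℝ} (ha : 0 < a)
    (h12 : B5.Prop12Printed (fun i => settingOf (torusRep P (levStd P i) (deltaAData (levStd_le i) a)) i)) :
    ∃ c r₁ : ℝ, 0 < c ∧ ∀ (k : ℕ) (hk : k ≤ P.m + P.K) (c' : ℝ), c' ≠ 0 → ∀ (w : ℝ), 0 < w → ∀ (r : ℝ), r₁ ≤ r →
      ∀ (cD : ℝ), |cD| ≤ 1 → ∀ (χ₂ : PBond P k → ℝ), (∀ b, |χ₂ b| ≤ 1) → ∀ (χb : TPlaq P k → PBond P k → ℝ), (∀ p b, |χb p b| ≤ 1) →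
      (∀ p b, (supDist p.src b.src : ℝ) ≤ r / 8 + 2 → χb p b = 1) →
        Ineq555 (TPlaq P k) (PBond P k)
          (fun p b => (∑ p', (trunc pdist r
              (fun p q => sigmaTorus (P := P) hd ((P.eta k) ^ P.d) ((P.L : ℝ) ^ k) k (toU P k (Pi.single q 1)) p) p p' -
              sigmaTorus (P := P) hd ((P.eta k) ^ P.d) ((P.L : ℝ) ^ k) k (toU P k (Pi.single p' 1)) p) *
            curl cD (fun b' => if b' = b then (1 : ℝ) else 0) p') * χ₂ b * χb p b)
          (fun p b => (∑ p', (trunc pdist r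
              (fun p q => sigmaTorus (P := P) hd ((P.eta k) ^ P.d) ((P.L : ℝ) ^ k) k (toU P k (Pi.single q 1)) p) p p' -
              sigmaTorus (P := P) hd ((P.eta k) ^ P.d) ((P.L : ℝ) ^ k) k (toU P k (Pi.single p' 1)) p) *
            curl cD (fun b' => if b' = b then (1 : ℝ) else 0) p') * χ₂ b * χb p b +
            (torusEdgeCellsTo P 0 k k (Nat.zero_add k) hd).Q
              (curl ((P.L : ℝ) ^ k) (fun b'' =>
                WithLp.ofLp (HkE P w c' k (toEj P k (Pi.single b 1))) b'' * χb p b -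
                  loc (cutoff (r / 16) (r / 8) (fun (b'' : PBond P 0) (b' : PBond P k) => distEU P k b''.src b'.src))
                    (fun b'' b' => WithLp.ofLp (HkE P w c' k (toEj P k (Pi.single b' 1))) b'') b'' b)) p * χ₂ b)
          c r := by
  obtain ⟨c₁, R₁, hc₁, h₁⟩ := ineq555_w3prime_torus hd ha h12
  obtain ⟨c₂, R₂, hc₂, h₂⟩ := ineq555_w3corr_torus hd ha h12
  have hm : 0 < min c₁ c₂ := lt_min hc₁ hc₂
  refine ⟨min c₁ c₂ / 2, max (max R₁ R₂) (2 / min c₁ c₂), by positivity, ?_⟩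
  intro k hk c' hc' w hw r hr cD hcD χ₂ hχ₂ χb hχb hbox
  have hR₁ : R₁ ≤ r := ((le_max_left _ _).trans (le_max_left _ _)).trans hr
  have hR₂ : R₂ ≤ r := ((le_max_right _ _).trans (le_max_left _ _)).trans hr
  have hr2 : 2 / min c₁ c₂ ≤ r := (le_max_right _ _).trans hr
  have hr0 : 0 ≤ r := le_trans (by positivity) hr2
  -- `e^{−c₁r}, e^{−c₂r} ≤ e^{−mr}` and `2e^{−mr} ≤ e^{−(m/2)r}` for `(m/2)r ≥ 1`
  have hmr : 1 ≤ min c₁ c₂ / 2 * r := by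
    rw [div_le_iff₀ hm] at hr2; linarith
  have htwo : 2 * Real.exp (-(min c₁ c₂ * r)) ≤ Real.exp (-(min c₁ c₂ / 2 * r)) := by
    have h2 : (2 : ℝ) ≤ Real.exp (min c₁ c₂ / 2 * r) := by linarith [Real.add_one_le_exp (min c₁ c₂ / 2 * r)]
    calc 2 * Real.exp (-(min c₁ c₂ * r)) ≤ Real.exp (min c₁ c₂ / 2 * r) * Real.exp (-(min c₁ c₂ * r)) :=
          mul_le_mul_of_nonneg_right h2 (Real.exp_pos _).le
      _ = Real.exp (-(min c₁ c₂ / 2 * r)) := by rw [← Real.exp_add]; ring_nf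
  have he₁ : Real.exp (-(c₁ * r)) ≤ Real.exp (-(min c₁ c₂ * r)) :=
    Real.exp_le_exp.2 (by nlinarith [min_le_left c₁ c₂])
  have he₂ : Real.exp (-(c₂ * r)) ≤ Real.exp (-(min c₁ c₂ * r)) :=
    Real.exp_le_exp.2 (by nlinarith [min_le_right c₁ c₂])
  have hone : Real.exp (-(min c₁ c₂ * r)) ≤ Real.exp (-(min c₁ c₂ / 2 * r)) := by
    linarith [Real.exp_pos (-(min c₁ c₂ * r))]
  refine ineq555_of_members (fun p b => ((h₁ k hk r hR₁ cD hcD χ₂ hχ₂ χb hχb p b).trans he₁).trans hone) fun p b => ?_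
  refine (abs_add_le _ _).trans ?_
  have hA := (h₁ k hk r hR₁ cD hcD χ₂ hχ₂ χb hχb p b).trans he₁
  have hB := (h₂ k hk c' hc' w hw r hR₂ χ₂ hχ₂ χb hχb hbox p b).trans he₂
  linarith

end

end Literature.MathematicalPhysics.QuantumFieldTheory.BalabanImbrieJaffe1984to88.BIJ88Ineq555W3CorrTorus
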